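import Mathlib
import HarnessLib
import Literature.MathematicalPhysics.StatisticalMechanics.AbkmPackageSlotF4Phi22
import Literature.MathematicalPhysics.StatisticalMechanics.StepOperatorBLipschitzUnifTorusFRD
import Literature.MathematicalPhysics.StatisticalMechanics.StepOperatorASecondDiffTorusFRD
import Literature.MathematicalPhysics.StatisticalMechanics.TuningLipschitzTorusFRD
import Literature.MathematicalPhysics.StatisticalMechanics.LastScaleKernelSubTorusFRD

/-!
# The first-order / `A_k` slots of `AbkmPackageSlots` HOLD with `N`-free sizes: (F4a), (F4a2), (F4b), (F4Φ2)
# ([ABKM19] Lemma 12.6 (12.51)–(12.52), Lemma 8.4 at the last scale) — PACKAGING of landed `N`-free theorems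

The nine `q`-slots of `F4Statement` (memo F4-H1BC-SIGNATURES) in the planner's `PackageData/PackageAt`
vocabulary.  Four of them are in the tree as `N`-free theorems over the 45-binder package telescope:
`norm_rgA_symm_one_add_sub_le_of_torusFRD` (F4a), `norm_rgA_symm_secondDiff_le_of_torusFRD` (F4a2),
`norm_rgBQ_sub_le_unif_of_torusFRD` (F4b, with `rgBT_of_mem`), `norm_integral_last_kernel_sub_le_of_torusFRD`
(F4Φ2, `activityNormLE ⇒ WeakNormLE / ContDiff / gauge-locality` for members of `activitySpace`, `e^{2KT} ≤ e^{2K}`).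
This file discharges the corresponding slots with explicit `N`-free sizes (Hölder data `ρ'' = (θ+θ̄)/2`,
`p = (1+ρ'')/(1+θ)` as in `AbkmPackageSlotF4Phi22`):

* **`f4a_of_packageAt`**, **`f4a2_of_packageAt`**, **`f4b_of_packageAt`**, **`f4Φ2_of_packageAt`** and the
  bundled **`exists_f4first_unif`** — `∀ P, ∃ aT bT aTT φT ≥ 0, ∀ N M Q, F4a ∧ F4b ∧ F4a2 ∧ F4Φ2`.

With `L2GaussianCore` (F4b2, F4Φ22 — `AbkmPackageSlotF4b2`) and `TwoKernelSkBound` (F4l) this leaves exactly the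
two `S_k` slots (F4l2), (F4l') of `F4Statement`.  Everything is proved; no named fact.  Honest scope: rung-route
slots, nothing about superconductivity in the Hubbard model.

## References
* S. Adams, S. Buchholz, R. Kotecký, S. Müller, arXiv:1910.13564, Lemma 8.4, Lemma 12.6 (12.51)–(12.52)
  [AdamsBuchholzKoteckyMuller2019].
* S. Buchholz, J. Funct. Anal. 275 (2018), Thm 4.5 [Buchholz2016].
-/

noncomputable section

namespace Literature.MathematicalPhysics.StatisticalMechanics.GradientRG

open scoped BigOperators
open Real Finset MeasureTheory
open Literature.MathematicalPhysics.StatisticalMechanics.GradientFRD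
  (fourierCoeff IsElliptic IsUnitSymm InShell iterDiff supNorm conv ellOp isElliptic_one)
open Literature.MathematicalPhysics.StatisticalMechanics.TorusPolymer (IsPolymer numBlocks isPolymer_univ)
open Literature.Barriers.CriticalPhenomena.LongRangePhi4.Polymer (IsConn)
open Literature.MathematicalPhysics.QuantumFieldTheory

variable {d : ℕ}

/-- **(F4a) with the `N`-free size `(secondDiffConst C_{·,1} + 1)/(4h²)`.**
[cite: AdamsBuchholzKoteckyMuller2019, Lemma 12.6 (12.51)] -/
theorem f4a_of_packageAt (P : PackageData d) [Fact (0 < P.h)] [Fact (0 < P.L)] {N M : ℕ} [NeZero M]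
    (Q : PackageAt P N M) :
    F4a P Q ((secondDiffConst (fun α => P.Cα α 1) + 1) / (4 * P.h ^ 2)) := by
  intro q q' hq hq' k hk w
  have hd2 : 2 ≤ d := by have := P.hd; omega
  have h := norm_rgA_symm_one_add_sub_le_of_torusFRD (fun A hA => (Q.hallA A hA).2.2.2.2.1) hd2 P.hn2 hq.1 hq'.1
    (hq.2.trans P.hT₀) (hq'.2.trans P.hT₀) (k := k) (by omega) w
  unfold esum
  exact h

/-- **(F4a2) with the `N`-free size `d⁴ · secondDiffConst C_{·,2} / h²`.**
[cite: AdamsBuchholzKoteckyMuller2019, Lemma 12.6 (12.51), ℓ = 2] -/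
theorem f4a2_of_packageAt (P : PackageData d) [Fact (0 < P.h)] [Fact (0 < P.L)] {N M : ℕ} [NeZero M]
    (Q : PackageAt P N M) :
    F4a2 P Q ((d : ℝ) ^ 4 * secondDiffConst (fun α => P.Cα α 2) / P.h ^ 2) := by
  intro q y z hq hqy hqz hqyz k hk w
  have hd2 : 2 ≤ d := by have := P.hd; omega
  have h := norm_rgA_symm_secondDiff_le_of_torusFRD (fun A hA => (Q.hallA A hA).2.2.2.2.1) hd2 P.hn2 P.hT₀
    hq hqy hqz hqyz (k := k) (by omega) w
  unfold esum
  exact h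

/-- **(F4b) with an `N`-free size** (`norm_rgBQ_sub_le_unif_of_torusFRD` through `rgBT_of_mem`).
[cite: AdamsBuchholzKoteckyMuller2019, Lemma 12.6 (12.52)] -/
theorem f4b_of_packageAt (P : PackageData d) [Fact (0 < P.h)] [Fact (0 < P.L)] {N M : ℕ} [NeZero M]
    (Q : PackageAt P N M) :
    F4b P Q
      ((P.L : ℝ) ^ d * (pi2BoundConst d (((2 * P.R + 2 : ℕ) : ℝ) + ((d / 2 + 1 : ℕ) : ℝ)) *
        ((P.r₀ + 1) * (8 * Real.conjExponent ((1 + (P.θ + P.θbar) / 2) / (1 + P.θ)) *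
            (Real.sqrt ((3 : ℝ) ^ (d + 1) * (((2 * ((2 * (2 ^ d + P.R) + 2 * P.pT + 1) + 1) : ℕ) : ℝ)) ^ d) * (Real.exp (2 * shellRatioConst P.c (P.Cℓ 1) (P.L : ℝ) d P.ñ) * shellRatioConst P.c (P.Cℓ 1) (P.L : ℝ) d P.ñ))) *
          ((2 : ℝ) ^ d * weightIntConstRho P.θbar ((P.θ + P.θbar) / 2)
            (traceConst d P.Mord P.R P.lam (derivSum d P.n fun θ' _ => P.Cα θ' 0)) ^ (1 / ((1 + (P.θ + P.θbar) / 2) / (1 + P.θ)))) *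
            P.A⁻¹))) := by
  intro q q' hq hq' k hk v cv hv
  set pH := ((1 + (P.θ + P.θbar) / 2) / (1 + P.θ)) with hpH
  set ρ'' := (P.θ + P.θbar) / 2 with hρ''def
  have hρ''0 : 0 ≤ ρ'' := by rw [hρ''def]; linarith [P.hθ0, P.hθ, P.hθbar]
  have hρ''θ : ρ'' < P.θbar := by rw [hρ''def]; linarith [P.hθ]
  have h1θ : 0 < 1 + P.θ := by linarith [P.hθ0]
  have hp1 : 1 < pH := by
    rw [hpH, one_lt_div h1θ]; linarith [P.hθ]
  have hpq : pH.HolderConjugate (Real.conjExponent pH) := Real.HolderConjugate.conjExponent hp1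
  have hpρ : pH * (1 + P.θ) ≤ 1 + ρ'' := by
    rw [hpH, hρ''def, div_mul_cancel₀ _ h1θ.ne']
  have h := norm_rgBQ_sub_le_unif_of_torusFRD P.hd P.hMord P.hMR P.hLodd P.hL Q.hM P.hθbar P.hlam P.hn P.hn2 P.hnñ
    P.hgap P.hc P.hC1 Q.hallA Q.hB P.hpM P.hr₀ P.hA1 P.hθ0 P.hθ P.hT₀ P.hKT₀ hpq hρ''0 hρ''θ hpρ hq.1 hq'.1 hq.2 hq'.2
    hk v hv
  unfold PackageAt.opB esum
  rw [rgBT_of_mem P.hd P.hMord P.hMR P.hLodd P.hL Q.hM P.hθbar P.hlam P.hn P.hn2 P.hnñ P.hc P.hC1 Q.hallA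
    Q.hB P.pT P.r₀ P.hr₀ P.A P.hθ0 P.hθ P.hT₀ P.hKT₀ hq'.1 hq'.2,
    rgBT_of_mem P.hd P.hMord P.hMR P.hLodd P.hL Q.hM P.hθbar P.hlam P.hn P.hn2 P.hnñ P.hc P.hC1 Q.hallA
    Q.hB P.pT P.r₀ P.hr₀ P.A P.hθ0 P.hθ P.hT₀ P.hKT₀ hq.1 hq.2]
  exact h

/-- **(F4Φ2) with an `N`-free size** (`norm_integral_last_kernel_sub_le_of_torusFRD`, `e^{2KT} ≤ e^{2K}`).
[cite: AdamsBuchholzKoteckyMuller2019, Lemma 8.4 (last scale)] -/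
theorem f4Φ2_of_packageAt (P : PackageData d) [Fact (0 < P.h)] [Fact (0 < P.L)] {N M : ℕ} [NeZero M]
    (Q : PackageAt P N M) :
    F4Φ2 P Q
      (P.A⁻¹ * ((P.r₀ + 1) * (8 * Real.conjExponent ((1 + (P.θ + P.θbar) / 2) / (1 + P.θ)) *
          (Real.sqrt ((3 : ℝ) ^ (d + 1)) * (Real.exp (2 * shellRatioConst P.c (P.Cℓ 1) (P.L : ℝ) d P.ñ) * shellRatioConst P.c (P.Cℓ 1) (P.L : ℝ) d P.ñ)))) *
        weightIntConstRho P.θbar ((P.θ + P.θbar) / 2)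
            (traceConst d P.Mord P.R P.lam (derivSum d P.n fun θ' _ => P.Cα θ' 0)) ^ (1 / ((1 + (P.θ + P.θbar) / 2) / (1 + P.θ)))) := by
  intro q q' hq hq' y cy hy _hc
  set pH := ((1 + (P.θ + P.θbar) / 2) / (1 + P.θ)) with hpH
  set ρ'' := (P.θ + P.θbar) / 2 with hρ''def
  have hρ''0 : 0 ≤ ρ'' := by rw [hρ''def]; linarith [P.hθ0, P.hθ, P.hθbar]
  have hρ''θ : ρ'' < P.θbar := by rw [hρ''def]; linarith [P.hθ]
  have h1θ : 0 < 1 + P.θ := by linarith [P.hθ0]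
  have hp1 : 1 < pH := by
    rw [hpH, one_lt_div h1θ]; linarith [P.hθ]
  have hpq : pH.HolderConjugate (Real.conjExponent pH) := Real.HolderConjugate.conjExponent hp1
  have hpρ : pH * (1 + P.θ) ≤ 1 + ρ'' := by
    rw [hpH, hρ''def, div_mul_cancel₀ _ h1θ.ne']
  have hA : 0 < P.A := by linarith [P.hA1]
  -- data of `y`
  have hMo : Odd M := by rw [Q.hM]; exact P.hLodd.pow
  have hyW : WeakNormLE Q.normParams N (y : Finset (Fin d → ZMod M) → ((Fin d → ZMod M) → ℝ) → ℂ) cy := hy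
  have hMt : M = Q.normParams.L ^ N * P.L ^ 0 := by
    show M = P.L ^ N * P.L ^ 0
    rw [pow_zero, mul_one]; exact Q.hM
  have hcy : 0 ≤ cy := nonneg_of_weakNormLE hA hMt P.hLodd.pow P.hLodd.pow hyW
  have hyd : ContDiff ℝ P.r₀ ((y : Finset (Fin d → ZMod M) → ((Fin d → ZMod M) → ℝ) → ℂ) univ) :=
    activitySpace.contDiff y univ
  have hΛp : IsPolymer (P.L ^ N) (univ : Finset (Fin d → ZMod M)) := isPolymer_univ _
  have hΛc : IsConn (univ : Finset (Fin d → ZMod M)) := isConn_top_univ hMo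
  have hyloc : IsGaugeLocal (Q.normParams.gauge N univ)
      ((y : Finset (Fin d → ZMod M) → ((Fin d → ZMod M) → ℝ) → ℂ) univ) :=
    activitySpace.isGaugeLocal y hΛp hΛc
  -- the `N`-free first-order bound for the pair `(q', q) := (q, q')`
  have h := norm_integral_last_kernel_sub_le_of_torusFRD P.hd P.hMord P.hMR P.hLodd P.hL Q.hM P.hθbar P.hlam P.hn
    P.hn2 P.hnñ P.hgap P.hc P.hC1 Q.hallA Q.hB P.hθ0 P.hθ P.hT₀ P.hKT₀ hq'.1 hq.1 hq'.2 hq.2 hpq hρ''0 hρ''θ hpρ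
    hA hcy hyW hyd hyloc (pT := P.pT) (r₀ := P.r₀) (h := P.h)
  refine h.trans ?_
  -- `T = Σ|q−q'| ≤ 1`, so `e^{2KT} ≤ e^{2K}`
  set T := ∑ i, ∑ j, |(q - q') i j| with hTdef
  have hT0 : 0 ≤ T := entrySum_nonneg _
  have hT1 : T ≤ 1 := by
    have h1 : T ≤ ∑ i, ∑ j, (|q i j| + |q' i j|) := by
      refine sum_le_sum fun i _ => sum_le_sum fun j _ => ?_
      rw [Matrix.sub_apply]; exact abs_sub _ _
    have h2 : ∑ i, ∑ j, (|q i j| + |q' i j|) = (∑ i, ∑ j, |q i j|) + ∑ i, ∑ j, |q' i j| := by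
      rw [← sum_add_distrib]; exact sum_congr rfl fun i _ => sum_add_distrib
    linarith [hq.2, hq'.2, P.hT₀]
  set K := shellRatioConst P.c (P.Cℓ 1) (P.L : ℝ) d P.ñ with hKdef
  have hK0 : 0 ≤ K := shellRatioConst_nonneg P.hc P.hC1 (Nat.cast_nonneg _) d P.ñ
  have hexp : Real.exp (2 * K * T) ≤ Real.exp (2 * K) := by
    refine Real.exp_le_exp.2 ?_
    calc 2 * K * T ≤ 2 * K * 1 := mul_le_mul_of_nonneg_left hT1 (by positivity)
      _ = 2 * K := mul_one _
  have hA𝒫p : 0 ≤ weightIntConstRho P.θbar ρ''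
      (traceConst d P.Mord P.R P.lam (derivSum d P.n fun θ' _ => P.Cα θ' 0)) :=
    zero_le_one.trans (one_le_weightIntConstRho P.hθbar hρ''0 hρ''θ
      (traceConst_nonneg d P.Mord P.R P.hlam.le (derivSum_nonneg d P.n _)))
  have hκ : 0 ≤ weightIntConstRho P.θbar ρ''
      (traceConst d P.Mord P.R P.lam (derivSum d P.n fun θ' _ => P.Cα θ' 0)) ^ (1 / pH) :=
    Real.rpow_nonneg hA𝒫p _
  have hq0 : 0 ≤ Real.conjExponent pH := by linarith [hpq.symm.lt]
  have hAinv : 0 ≤ P.A⁻¹ := inv_nonneg.2 hA.le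
  have hstep : T * Real.exp (2 * K * T) * K ≤ Real.exp (2 * K) * K * T := by
    calc T * Real.exp (2 * K * T) * K ≤ T * Real.exp (2 * K) * K := by gcongr
      _ = Real.exp (2 * K) * K * T := by ring
  unfold esum
  calc cy * P.A⁻¹ * ((P.r₀ + 1) * (8 * Real.conjExponent pH * (Real.sqrt ((3 : ℝ) ^ (d + 1)) *
          (T * Real.exp (2 * K * T) * K)))) *
          weightIntConstRho P.θbar ρ'' (traceConst d P.Mord P.R P.lam (derivSum d P.n fun θ' _ => P.Cα θ' 0)) ^ (1 / pH)
      ≤ cy * P.A⁻¹ * ((P.r₀ + 1) * (8 * Real.conjExponent pH * (Real.sqrt ((3 : ℝ) ^ (d + 1)) *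
          (Real.exp (2 * K) * K * T)))) *
          weightIntConstRho P.θbar ρ'' (traceConst d P.Mord P.R P.lam (derivSum d P.n fun θ' _ => P.Cα θ' 0)) ^ (1 / pH) := by
        gcongr
    _ = _ := by ring

/-- **The four first-order / `A_k` slots with `N`-free sizes, bundled**: for every package there are
`a_T, b_T, a_TT, φ_T ≥ 0` with (F4a), (F4b), (F4a2), (F4Φ2) at every height.
[cite: AdamsBuchholzKoteckyMuller2019, Lemma 12.6 (12.51)–(12.52) / Lemma 8.4] -/
theorem exists_f4first_unif (P : PackageData d) [Fact (0 < P.h)] [Fact (0 < P.L)] :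
    ∃ aT bT aTT φT : ℝ, 0 ≤ aT ∧ 0 ≤ bT ∧ 0 ≤ aTT ∧ 0 ≤ φT ∧
      ∀ (N M : ℕ) [NeZero M] (Q : PackageAt P N M),
        F4a P Q aT ∧ F4b P Q bT ∧ F4a2 P Q aTT ∧ F4Φ2 P Q φT := by
  set pH := ((1 + (P.θ + P.θbar) / 2) / (1 + P.θ)) with hpH
  have hA : 0 < P.A := by linarith [P.hA1]
  have hρ''0 : 0 ≤ (P.θ + P.θbar) / 2 := by linarith [P.hθ0, P.hθ, P.hθbar]
  have hρ''θ : (P.θ + P.θbar) / 2 < P.θbar := by linarith [P.hθ]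
  have hA𝒫p : 0 ≤ weightIntConstRho P.θbar ((P.θ + P.θbar) / 2)
      (traceConst d P.Mord P.R P.lam (derivSum d P.n fun θ' _ => P.Cα θ' 0)) :=
    zero_le_one.trans (one_le_weightIntConstRho P.hθbar hρ''0 hρ''θ
      (traceConst_nonneg d P.Mord P.R P.hlam.le (derivSum_nonneg d P.n _)))
  have h1θ : 0 < 1 + P.θ := by linarith [P.hθ0]
  have hp1 : 1 < pH := by
    rw [hpH, one_lt_div h1θ]; linarith [P.hθ]
  have hq0 : 0 ≤ Real.conjExponent pH := by
    have := (Real.HolderConjugate.conjExponent hp1).symm.lt; linarith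
  have hK1 : 0 ≤ shellRatioConst P.c (P.Cℓ 1) (P.L : ℝ) d P.ñ :=
    shellRatioConst_nonneg P.hc P.hC1 (Nat.cast_nonneg _) d P.ñ
  have hκ : 0 ≤ weightIntConstRho P.θbar ((P.θ + P.θbar) / 2)
      (traceConst d P.Mord P.R P.lam (derivSum d P.n fun θ' _ => P.Cα θ' 0)) ^ (1 / pH) :=
    Real.rpow_nonneg hA𝒫p _
  have hAinv : 0 ≤ P.A⁻¹ := inv_nonneg.2 hA.le
  have hC87 : 0 ≤ pi2BoundConst d (((2 * P.R + 2 : ℕ) : ℝ) + ((d / 2 + 1 : ℕ) : ℝ)) :=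
    pi2BoundConst_nonneg d (by positivity)
  have hS1 : 0 ≤ secondDiffConst (fun α => P.Cα α 1) := secondDiffConst_nonneg _
  have hS2 : 0 ≤ secondDiffConst (fun α => P.Cα α 2) := secondDiffConst_nonneg _
  have hh : 0 < P.h := P.hh
  refine ⟨_, _, _, _, ?_, ?_, ?_, ?_, fun N M _ Q =>
    ⟨f4a_of_packageAt P Q, f4b_of_packageAt P Q, f4a2_of_packageAt P Q, f4Φ2_of_packageAt P Q⟩⟩
  · positivity
  · positivity
  · positivity
  · positivity

end Literature.MathematicalPhysics.StatisticalMechanics.GradientRG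

end
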